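import Mathlib

/-!
# Crux `NoHeavyLowerTail` (stmt-CriticalPhenomena-4575), certificate programme for the `|A| = 5` one-cut rung:
# two-copy (Bernstein bidegree-2) certificates — the generic algebra and its checker

A polynomial identity of the shape

  `Φ(w) = Σ_j λ_j(w) · T_j(w) − ν(w) · H(w)`,  `λ_j(w) = E_w[a_j]`, `T_j(w) = E_w[t_j]`, `ν = E_w[b]`, `H = E_w[h]`,

where `E_w[f] = Σ_{c < 2^m} f(c) · wt_w(c)` is the expectation of a function of a configuration `c`
(a bit mask over `m` coordinates, coordinate `i` open iff bit `i` of `c` is set) under the product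
measure with coordinate probabilities `w_0 … w_{m-1}`, expands over PAIRS of configurations
`(c₁, c₂)` (two independent copies).  Grouping the pairs by the fibre `s = 1_{c₁} + 1_{c₂} ∈ {0,1,2}^m`,
encoded as the pair of disjoint masks `(S₂, S₁) = (c₁ &&& c₂, c₁ ^^^ c₂)`, the weight
`wt_w(c₁) wt_w(c₂)` is the fibre monomial `Π_{S₂} w_i² · Π_{S₁} w_i(1−w_i) · Π_{rest} (1−w_i)²`
(`wt_mul_wt`), which is nonnegative on the cube.  Hence `Φ(w) ≥ 0` on `[0,1]^m` as soon as every
fibre coefficient `Σ_{T ⊆ S₁} G(S₂ ∪ T, S₂ ∪ (S₁ ∖ T))`, `G(c₁,c₂) = Σ_j a_j(c₂) t_j(c₁) − b(c₂) h(c₁)`,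
is nonnegative (`twoCopy_nonneg_of_check`) — a finite check (`twoCopyCheck`, meant for
`native_decide`/`decide`) on integer data.  This file is measure-free bookkeeping; the link to bond
percolation (`E_w[·]` = probabilities of connection events) and the certificates themselves live in
the companion files.  Nothing here asserts anything about the crux.
-/

namespace Summit.CriticalPhenomena.PercolationContinuityZ3.Theorems.TwoCopy

open Finset

/-! ## Weights, monomials, expectations -/

/-- Weight of the configuration `c` under coordinate probabilities `w`: `Π_{i<m} (w_i if bit i of c else 1 − w_i)`. [this work] -/
def wt (m : ℕ) (w : ℕ → ℝ) (c : ℕ) : ℝ :=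
  ∏ i ∈ range m, if c.testBit i then w i else 1 - w i

/-- The two-copy monomial of the fibre `(S₂, S₁)`: `Π_{S₂} w_i² Π_{S₁} w_i(1−w_i) Π_{rest} (1−w_i)²`. [this work] -/
def mono (m : ℕ) (w : ℕ → ℝ) (S2 S1 : ℕ) : ℝ :=
  ∏ i ∈ range m, if S2.testBit i then w i * w i else if S1.testBit i then w i * (1 - w i) else (1 - w i) * (1 - w i)

/-- Expectation of a configuration function: `E_w[f] = Σ_{c < 2^m} f(c) wt_w(c)`. [this work] -/
def ex (m : ℕ) (w : ℕ → ℝ) (f : ℕ → ℝ) : ℝ :=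
  ∑ c ∈ range (2 ^ m), f c * wt m w c

/-- The product of the weights of two configurations is the monomial of their fibre. [this work] -/
theorem wt_mul_wt (m : ℕ) (w : ℕ → ℝ) (c1 c2 : ℕ) :
    wt m w c1 * wt m w c2 = mono m w (c1 &&& c2) (c1 ^^^ c2) := by
  unfold wt mono
  rw [← prod_mul_distrib]
  refine prod_congr rfl fun i _ => ?_
  rw [Nat.testBit_and, Nat.testBit_xor]
  cases c1.testBit i <;> cases c2.testBit i <;> simp [mul_comm]

/-- Fibre monomials are nonnegative on the cube. [this work] -/
theorem mono_nonneg (m : ℕ) {w : ℕ → ℝ} (hw : ∀ i, 0 ≤ w i ∧ w i ≤ 1) (S2 S1 : ℕ) :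
    0 ≤ mono m w S2 S1 := by
  unfold mono
  refine prod_nonneg fun i _ => ?_
  have h0 := (hw i).1; have h1 : 0 ≤ 1 - w i := sub_nonneg.2 (hw i).2
  split_ifs <;> positivity

/-- Weights are nonnegative on the cube. [this work] -/
theorem wt_nonneg (m : ℕ) {w : ℕ → ℝ} (hw : ∀ i, 0 ≤ w i ∧ w i ≤ 1) (c : ℕ) : 0 ≤ wt m w c := by
  unfold wt
  refine prod_nonneg fun i _ => ?_
  have h0 := (hw i).1; have h1 : 0 ≤ 1 - w i := sub_nonneg.2 (hw i).2
  split_ifs <;> assumption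

/-- Weights are positive on the OPEN cube. [this work] -/
theorem wt_pos (m : ℕ) {w : ℕ → ℝ} (hw : ∀ i, 0 < w i ∧ w i < 1) (c : ℕ) : 0 < wt m w c := by
  unfold wt
  refine prod_pos fun i _ => ?_
  have h0 := (hw i).1; have h1 : 0 < 1 - w i := sub_pos.2 (hw i).2
  split_ifs <;> assumption

/-- `E_w` is monotone in the function for weights in the cube. [this work] -/
theorem ex_nonneg (m : ℕ) {w : ℕ → ℝ} (hw : ∀ i, 0 ≤ w i ∧ w i ≤ 1) {f : ℕ → ℝ} (hf : ∀ c, 0 ≤ f c) :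
    0 ≤ ex m w f :=
  sum_nonneg fun c _ => mul_nonneg (hf c) (wt_nonneg m hw c)

/-- `E_w` is linear: subtraction. [this work] -/
theorem ex_sub (m : ℕ) (w : ℕ → ℝ) (f g : ℕ → ℝ) : ex m w (fun c => f c - g c) = ex m w f - ex m w g := by
  simp only [ex, sub_mul, sum_sub_distrib]

/-- `E_w` is linear: finite sums. [this work] -/
theorem ex_sum (m : ℕ) (w : ℕ → ℝ) {ι : Type*} (s : Finset ι) (f : ι → ℕ → ℝ) :
    ex m w (fun c => ∑ j ∈ s, f j c) = ∑ j ∈ s, ex m w (f j) := by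
  simp only [ex, sum_mul]
  rw [sum_comm]

/-- `E_w` is linear: scalars. [this work] -/
theorem ex_const_mul (m : ℕ) (w : ℕ → ℝ) (a : ℝ) (f : ℕ → ℝ) : ex m w (fun c => a * f c) = a * ex m w f := by
  simp only [ex, mul_sum, mul_assoc]

/-! ## Bit-mask bookkeeping -/

/-- Masks below `2^m` are closed under `&&&`. [folklore] -/
theorem and_lt_two_pow {m c1 c2 : ℕ} (h1 : c1 < 2 ^ m) : c1 &&& c2 < 2 ^ m :=
  lt_of_le_of_lt Nat.and_le_left h1

/-- Masks below `2^m` are closed under `^^^`. [folklore] -/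
theorem xor_lt_two_pow {m c1 c2 : ℕ} (h1 : c1 < 2 ^ m) (h2 : c2 < 2 ^ m) : c1 ^^^ c2 < 2 ^ m :=
  Nat.xor_lt_two_pow h1 h2

/-- Masks below `2^m` are closed under `|||`. [folklore] -/
theorem or_lt_two_pow {m c1 c2 : ℕ} (h1 : c1 < 2 ^ m) (h2 : c2 < 2 ^ m) : c1 ||| c2 < 2 ^ m :=
  Nat.or_lt_two_pow h1 h2

/-- The fibre key of a pair of configurations. [this work] -/
def key (x : ℕ × ℕ) : ℕ × ℕ := (x.1 &&& x.2, x.1 ^^^ x.2)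

/-- The parametrisation of a fibre: `T ⊆ S₁ ↦ (S₂ ∪ T, S₂ ∪ (S₁ ∖ T))`. [this work] -/
def param (S2 S1 T : ℕ) : ℕ × ℕ := (S2 ||| T, S2 ||| (S1 ^^^ T))

/-- The inverse parametrisation: the bits of `c₁` that are not in `c₂`. [this work] -/
def unparam (x : ℕ × ℕ) : ℕ := x.1 &&& (x.1 ^^^ x.2)

/-- `key ∘ param = (S₂, S₁)` on disjoint masks and sub-masks. [this work] -/
theorem key_param {S2 S1 T : ℕ} (hd : S2 &&& S1 = 0) (hT : T &&& S1 = T) : key (param S2 S1 T) = (S2, S1) := by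
  have hd' : ∀ i, (S2.testBit i && S1.testBit i) = false := fun i => by
    have := congrArg (fun n => n.testBit i) hd; simpa [Nat.testBit_and] using this
  have hT' : ∀ i, (T.testBit i && S1.testBit i) = T.testBit i := fun i => by
    have := congrArg (fun n => n.testBit i) hT; simpa [Nat.testBit_and] using this
  unfold key param
  ext
  · refine Nat.eq_of_testBit_eq fun i => ?_
    have h1 := hd' i; have h2 := hT' i
    simp only [Nat.testBit_and, Nat.testBit_or, Nat.testBit_xor] at h1 h2 ⊢
    cases hS2 : S2.testBit i <;> cases hS1 : S1.testBit i <;> cases hTT : T.testBit i <;> simp_all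
  · refine Nat.eq_of_testBit_eq fun i => ?_
    have h1 := hd' i; have h2 := hT' i
    simp only [Nat.testBit_or, Nat.testBit_xor] at h1 h2 ⊢
    cases hS2 : S2.testBit i <;> cases hS1 : S1.testBit i <;> cases hTT : T.testBit i <;> simp_all

/-- `unparam ∘ param = id` on disjoint masks and sub-masks. [this work] -/
theorem unparam_param {S2 S1 T : ℕ} (hd : S2 &&& S1 = 0) (hT : T &&& S1 = T) : unparam (param S2 S1 T) = T := by
  have hd' : ∀ i, (S2.testBit i && S1.testBit i) = false := fun i => by
    have := congrArg (fun n => n.testBit i) hd; simpa [Nat.testBit_and] using this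
  have hT' : ∀ i, (T.testBit i && S1.testBit i) = T.testBit i := fun i => by
    have := congrArg (fun n => n.testBit i) hT; simpa [Nat.testBit_and] using this
  unfold unparam param
  refine Nat.eq_of_testBit_eq fun i => ?_
  have h1 := hd' i; have h2 := hT' i
  simp only [Nat.testBit_and, Nat.testBit_or, Nat.testBit_xor] at h1 h2 ⊢
  cases hS2 : S2.testBit i <;> cases hS1 : S1.testBit i <;> cases hTT : T.testBit i <;> simp_all

/-- `param ∘ unparam = id` on a fibre. [this work] -/
theorem param_unparam {x : ℕ × ℕ} {S2 S1 : ℕ} (hk : key x = (S2, S1)) : param S2 S1 (unparam x) = x := by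
  unfold key at hk
  simp only [Prod.mk.injEq] at hk
  obtain ⟨h1, h2⟩ := hk
  subst h1; subst h2
  unfold param unparam
  ext
  · refine Nat.eq_of_testBit_eq fun i => ?_
    simp only [Nat.testBit_and, Nat.testBit_or, Nat.testBit_xor]
    cases x.1.testBit i <;> cases x.2.testBit i <;> simp
  · refine Nat.eq_of_testBit_eq fun i => ?_
    simp only [Nat.testBit_and, Nat.testBit_or, Nat.testBit_xor]
    cases x.1.testBit i <;> cases x.2.testBit i <;> simp

/-- `unparam` of a fibre element is a sub-mask of `S₁`. [this work] -/
theorem unparam_and {x : ℕ × ℕ} {S2 S1 : ℕ} (hk : key x = (S2, S1)) : unparam x &&& S1 = unparam x := by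
  unfold key at hk
  simp only [Prod.mk.injEq] at hk
  obtain ⟨h1, h2⟩ := hk
  subst h2
  unfold unparam
  refine Nat.eq_of_testBit_eq fun i => ?_
  simp only [Nat.testBit_and, Nat.testBit_xor]
  cases x.1.testBit i <;> cases x.2.testBit i <;> simp

/-- The two parts of a key are disjoint. [this work] -/
theorem key_disjoint (x : ℕ × ℕ) : (key x).1 &&& (key x).2 = 0 := by
  unfold key
  refine Nat.eq_of_testBit_eq fun i => ?_
  simp only [Nat.testBit_and, Nat.testBit_xor, Nat.zero_testBit]
  cases x.1.testBit i <;> cases x.2.testBit i <;> simp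

/-! ## Fibre sums and the checker -/

/-- The fibre coefficient: `Σ_{T ⊆ S₁, T < 2^m} G(S₂ ∪ T, S₂ ∪ (S₁ ∖ T))`. [this work] -/
def fib {α : Type*} [AddCommMonoid α] (m : ℕ) (G : ℕ → ℕ → α) (S2 S1 : ℕ) : α :=
  ∑ T ∈ (range (2 ^ m)).filter (fun T => T &&& S1 = T), G (S2 ||| T) (S2 ||| (S1 ^^^ T))

/-- The integrand of a two-copy certificate: `G(c₁, c₂) = Σ_{j<K} t_j(c₁) a_j(c₂) − h(c₁) b(c₂)`. [this work] -/
def pairing (K : ℕ) (t : ℕ → ℕ → ℤ) (h : ℕ → ℤ) (a : ℕ → ℕ → ℕ) (b : ℕ → ℕ) (c1 c2 : ℕ) : ℤ :=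
  (∑ j ∈ range K, t j c1 * (a j c2 : ℤ)) - h c1 * (b c2 : ℤ)

/-- THE CHECK: every fibre coefficient of the certificate `(a, b)` for the targets `t` and the
hypothesis `h` is nonnegative (fibres with overlapping masks are empty and skipped). [this work] -/
def twoCopyCheck (m K : ℕ) (t : ℕ → ℕ → ℤ) (h : ℕ → ℤ) (a : ℕ → ℕ → ℕ) (b : ℕ → ℕ) : Bool :=
  (List.range (2 ^ m)).all fun S1 => (List.range (2 ^ m)).all fun S2 =>
    (S2 &&& S1 != 0) || decide (0 ≤ fib m (pairing K t h a b) S2 S1)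

/-- What a passed check says about one fibre. [this work] -/
theorem fib_nonneg_of_check {m K : ℕ} {t : ℕ → ℕ → ℤ} {h : ℕ → ℤ} {a : ℕ → ℕ → ℕ} {b : ℕ → ℕ}
    (hc : twoCopyCheck m K t h a b = true) {S2 S1 : ℕ} (hS2 : S2 < 2 ^ m) (hS1 : S1 < 2 ^ m)
    (hd : S2 &&& S1 = 0) : 0 ≤ fib m (pairing K t h a b) S2 S1 := by
  unfold twoCopyCheck at hc
  have h1 := List.all_eq_true.1 hc S1 (List.mem_range.2 hS1)
  have h2 := List.all_eq_true.1 h1 S2 (List.mem_range.2 hS2)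
  rw [Bool.or_eq_true] at h2
  rcases h2 with h2 | h2
  · exact absurd hd (by simpa using h2)
  · exact of_decide_eq_true h2

/-! ## Soundness: a passed check makes `Φ(w) ≥ 0` on the cube -/

/-- The two-copy polynomial `Φ(w) = Σ_j E_w[t_j] E_w[a_j] − E_w[h] E_w[b]`. [this work] -/
noncomputable def Phi (m K : ℕ) (t : ℕ → ℕ → ℤ) (h : ℕ → ℤ) (a : ℕ → ℕ → ℕ) (b : ℕ → ℕ) (w : ℕ → ℝ) : ℝ :=
  (∑ j ∈ range K, ex m w (fun c => (t j c : ℝ)) * ex m w (fun c => (a j c : ℝ))) -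
    ex m w (fun c => (h c : ℝ)) * ex m w (fun c => (b c : ℝ))

/-- Expansion of `Φ` over pairs of configurations with the fibre monomial as weight. [this work] -/
theorem Phi_eq_sum_pairs (m K : ℕ) (t : ℕ → ℕ → ℤ) (h : ℕ → ℤ) (a : ℕ → ℕ → ℕ) (b : ℕ → ℕ) (w : ℕ → ℝ) :
    Phi m K t h a b w = ∑ x ∈ range (2 ^ m) ×ˢ range (2 ^ m),
      (pairing K t h a b x.1 x.2 : ℝ) * mono m w (key x).1 (key x).2 := by
  have hprod : ∀ f g : ℕ → ℝ, ex m w f * ex m w g =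
      ∑ x ∈ range (2 ^ m) ×ˢ range (2 ^ m), (f x.1 * g x.2) * mono m w (key x).1 (key x).2 := by
    intro f g
    unfold ex
    rw [sum_mul_sum, sum_product]
    refine sum_congr rfl fun c1 _ => sum_congr rfl fun c2 _ => ?_
    unfold key
    rw [← wt_mul_wt]; ring
  have hR : ∀ x : ℕ × ℕ, (pairing K t h a b x.1 x.2 : ℝ) * mono m w (key x).1 (key x).2 =
      (∑ j ∈ range K, ((t j x.1 : ℝ) * (a j x.2 : ℝ)) * mono m w (key x).1 (key x).2) -
        ((h x.1 : ℝ) * (b x.2 : ℝ)) * mono m w (key x).1 (key x).2 := by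
    intro x
    unfold pairing
    push_cast
    rw [sub_mul, sum_mul]
  rw [sum_congr rfl fun x _ => hR x, sum_sub_distrib, sum_comm]
  unfold Phi
  simp only [hprod]

/-- Regrouping by fibres: `Φ(w) = Σ_{(S₂,S₁)} mono_{S₂,S₁}(w) · Σ_{x : key x = (S₂,S₁)} G(x)`. [this work] -/
theorem Phi_eq_sum_fibres (m K : ℕ) (t : ℕ → ℕ → ℤ) (h : ℕ → ℤ) (a : ℕ → ℕ → ℕ) (b : ℕ → ℕ) (w : ℕ → ℝ) :
    Phi m K t h a b w = ∑ k ∈ range (2 ^ m) ×ˢ range (2 ^ m), mono m w k.1 k.2 *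
      ∑ x ∈ (range (2 ^ m) ×ˢ range (2 ^ m)).filter (fun x => key x = k), (pairing K t h a b x.1 x.2 : ℝ) := by
  rw [Phi_eq_sum_pairs]
  have hmaps : ∀ x ∈ range (2 ^ m) ×ˢ range (2 ^ m), key x ∈ range (2 ^ m) ×ˢ range (2 ^ m) := by
    intro x hx
    simp only [mem_product, mem_range] at hx ⊢
    exact ⟨and_lt_two_pow hx.1, xor_lt_two_pow hx.1 hx.2⟩
  rw [← sum_fiberwise_of_maps_to hmaps]
  refine sum_congr rfl fun k _ => ?_
  rw [mul_sum]
  refine sum_congr rfl fun x hx => ?_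
  rw [(mem_filter.1 hx).2]; ring

/-- On a fibre `(S₂, S₁)` with `S₂ &&& S₁ = 0`, the sum over the fibre is the `T ⊆ S₁` sum `fib`. [this work] -/
theorem sum_fibre_eq_fib (m : ℕ) (G : ℕ → ℕ → ℝ) {S2 S1 : ℕ} (hS2 : S2 < 2 ^ m) (hS1 : S1 < 2 ^ m)
    (hd : S2 &&& S1 = 0) :
    ∑ x ∈ (range (2 ^ m) ×ˢ range (2 ^ m)).filter (fun x => key x = (S2, S1)), G x.1 x.2 = fib m G S2 S1 := by
  unfold fib
  symm
  refine sum_bij' (fun T _ => param S2 S1 T) (fun x _ => unparam x) ?_ ?_ ?_ ?_ ?_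
  · intro T hT
    rw [mem_filter, mem_range] at hT
    rw [mem_filter, mem_product, mem_range, mem_range, key_param hd hT.2]
    refine ⟨⟨or_lt_two_pow hS2 hT.1, or_lt_two_pow hS2 (xor_lt_two_pow hS1 hT.1)⟩, rfl⟩
  · intro x hx
    rw [mem_filter, mem_product, mem_range, mem_range] at hx
    rw [mem_filter, mem_range]
    refine ⟨?_, unparam_and hx.2⟩
    unfold unparam
    exact and_lt_two_pow hx.1.1
  · intro T hT
    rw [mem_filter] at hT
    exact unparam_param hd hT.2
  · intro x hx
    rw [mem_filter] at hx
    exact param_unparam hx.2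
  · intro T hT
    rfl

/-- **Soundness of the two-copy check.** If every fibre coefficient is nonnegative then
`Φ(w) = Σ_j E_w[a_j] E_w[t_j] − E_w[b] E_w[h] ≥ 0` for every `w ∈ [0,1]^m`. [this work] -/
theorem twoCopy_nonneg_of_check {m K : ℕ} {t : ℕ → ℕ → ℤ} {h : ℕ → ℤ} {a : ℕ → ℕ → ℕ} {b : ℕ → ℕ}
    (hc : twoCopyCheck m K t h a b = true) {w : ℕ → ℝ} (hw : ∀ i, 0 ≤ w i ∧ w i ≤ 1) :
    0 ≤ Phi m K t h a b w := by
  rw [Phi_eq_sum_fibres]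
  refine sum_nonneg fun k hk => mul_nonneg (mono_nonneg m hw _ _) ?_
  obtain ⟨S2, S1⟩ := k
  rw [mem_product, mem_range, mem_range] at hk
  by_cases hd : S2 &&& S1 = 0
  · rw [sum_fibre_eq_fib m (fun c1 c2 => (pairing K t h a b c1 c2 : ℝ)) hk.1 hk.2 hd]
    have hz : 0 ≤ fib m (pairing K t h a b) S2 S1 := fib_nonneg_of_check hc hk.1 hk.2 hd
    have hcast : ((fib m (pairing K t h a b) S2 S1 : ℤ) : ℝ) =
        fib m (fun c1 c2 => (pairing K t h a b c1 c2 : ℝ)) S2 S1 := by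
      unfold fib; push_cast; rfl
    rw [← hcast]; exact_mod_cast hz
  · have hempty : (range (2 ^ m) ×ˢ range (2 ^ m)).filter (fun x => key x = (S2, S1)) = ∅ := by
      refine filter_eq_empty_iff.2 fun x _ hx => hd ?_
      have := key_disjoint x
      rw [hx] at this
      exact this
    rw [hempty, sum_empty]

/-- The conclusion in the form used downstream: if the check passes and `E_w[h] ≥ 0` then
`Σ_j E_w[a_j] · E_w[t_j] ≥ 0`. [this work] -/
theorem sum_ex_mul_ex_nonneg_of_check {m K : ℕ} {t : ℕ → ℕ → ℤ} {h : ℕ → ℤ} {a : ℕ → ℕ → ℕ} {b : ℕ → ℕ}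
    (hc : twoCopyCheck m K t h a b = true) {w : ℕ → ℝ} (hw : ∀ i, 0 ≤ w i ∧ w i ≤ 1)
    (hh : 0 ≤ ex m w (fun c => (h c : ℝ))) :
    0 ≤ ∑ j ∈ range K, ex m w (fun c => (t j c : ℝ)) * ex m w (fun c => (a j c : ℝ)) := by
  have h1 := twoCopy_nonneg_of_check hc hw
  unfold Phi at h1
  have h2 : 0 ≤ ex m w (fun c => (h c : ℝ)) * ex m w (fun c => (b c : ℝ)) :=
    mul_nonneg hh (ex_nonneg m hw fun c => Nat.cast_nonneg _)
  linarith

end Summit.CriticalPhenomena.PercolationContinuityZ3.Theorems.TwoCopy
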